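import Literature.IUT.HodgeArakelov.BadPrimeGaussianMonoidsCor36Proofs
import Literature.IUT.HodgeArakelov.BadPrimeGaussianMonoidsSyncInftyTorsionProofs
import Literature.IUT.HodgeArakelov.BadPrimeGaussianMonoidsCohomologyModelProofs2
import Mathlib.GroupTheory.OrderOfElement
import HarnessLib

/-!
# [IUTchII] Cor 3.6 (ii) at the `∞`-level, FAITHFUL FORM: the Galois compatibility «↷» of the
# Frobenioid-theoretic Gaussian monoids `∞Ψ_{F_ξ}(†F_v)` UP TO TORSION, by transport along the Kummer copies
# (proof-only companion no. 6 of `BadPrimeGaussianMonoids.lean`; sequel to `BadPrimeGaussianMonoidsCor36Proofs.lean`)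

S. Mochizuki, *Inter-universal Teichmüller theory II*, §3, kurims Dec-2020 manuscript, Cor 3.6 (ii) p.100,
Cor 3.5 (ii) p.95, Remark 3.6.1 p.101 (IUTchII §3 Cor 3.6, kurims pp.99–101) [claim: Mochizuki2012, status: disputed]
(D-0012 claim key; nothing disputed is asserted here — every theorem below is elementary monoid algebra over the
REAL objects of abc-iut-L6-t2's `BadPrimeGaussianMonoids.lean`). abc-iut cell, D-0068 sub-DAG
`plan/L6/SUBDAG-IUTchII-Cor-36.md` row Cor-36.ii.r9 (holder abc-iut-w5-d192). NO definition, NO `Prop` fact; hypotheses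
inline in Mathlib vocabulary; print references are PARAPHRASES with page/line locators on the writer's render
(paper:url-5036b4059555), not quotations.

WHY THIS FILE. `BadPrimeGaussianMonoidsCor36Proofs.lean` §1 transports EXACT diagonal `G_v,⟨F_l^⋇⟩`-stability of a
submonoid `S ⊆ ∏_{|t|} Ψ_cns,|t|` to its Frobenioid-theoretic copy `(piIso e)⁻¹(S)` (`map_piIso_comap_eq_of_equivariant`,
`inftyFrobenioidGaussianMonoid_diagonalStable_of_equivariant`). abc-iut-w5-d131's kernel certificate
`BadPrimeGaussianMonoidsSyncInftyNegative.lean` (`not_diagonalStable`; review lane) and the faithful sequel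
`BadPrimeGaussianMonoidsSyncInftyTorsionProofs.lean` (p417474: `pi_conj_eq_mul_piIso_upToTorsion`,
`pi_restriction_inftyThetaMonoid_upToTorsion_of_kummer_of_fixed`; at the cohomology model abc-iut-w4-d004's
`pi_restriction_inftyThetaMonoid_upToTorsion_ofCohomologyModel`, p417978) show that at the PRINTED `∞`-monoid
«`ξ^{ℚ≥0}` … the `N`-th roots [which are uniquely determined, up to multiplication by an element of the `N`-torsion
subgroup of `Ψ^×_cns(M^Θ_*)_{⟨F_l^⋇⟩}`!] that arise by restricting» (Cor 3.5 (ii), p.95 l.2–8, paraphrase) the exact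
hypothesis is of the idle kind: the `Ψ`-level inputs give diagonal compatibility only UP TO a family of torsion
elements (Rmk 3.6.1 «Galois compatibility … involving the monoids `∞Ψ`», p.101 l.6–9, paraphrase). The theorems
below are the matching form of Cor 3.6 (ii)'s «↷» at the `∞`-level: stability up to torsion (more generally up
to a family with values in any set `U`) TRANSPORTS along the labeled Kummer copies `piIso T e`, because `e` is a
multiplicative isomorphism; and the synchronization-up-to-torsion identity delivered by the Cor 3.5 (ii) files
yields exactly that stability for the image monoid (`exists_torsion_mul_mem_map_of_sync`, no inverses needed).
abc-iut-L6-t2's `rootPowers` reading `inftyGaussianMonoid ξ` is exactly diagonally stable (a different, larger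
object), so that file's exact `∞`-version remains the junction for it; the faithful form is the one to instantiate at
abc-iut-w5-d031's printed-exact `∞`-monoid (`Sinf'.comap (piIso T e).toMonoidHom`, `mrange_pi_eq_inftyArising`,
p413084) and at the cohomology-model outputs. Residual named input, unchanged: the `G`-equivariance `hequiv` of the
Kummer isomorphism `e` (Prop 3.3 (ii); GAP-LEDGER G-w4d019-1 datum).
HONEST FRAMING: elementary algebra; nothing here bears on [IUTchIII] Cor. 3.12; no side taken; typed ≠ endorsed. [v5 doc-only: locators p.95 l.3–7 / p.101 l.6–9 corrected.]
-/

namespace Literature.IUT.HodgeArakelov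

namespace BadPrimeGaussianMonoids

open TemperedThetaMonoids

universe u v w x

/-! ### [Cor-36.ii.r9, `∞`-level] transport of diagonal stability UP TO TORSION -/

section UpToTorsion

variable {T : Type u} {M : Type v} [CommMonoid M] {N : Type w} [CommMonoid N]
  {G : Type*} [Group G] (γ : G →* MulAut N) (β : G →* MulAut M) (e : N ≃* M)

/-- **Transport of stability up to a `U`-valued family** (Cor 3.6 (ii) p.100 l.23–26 with Cor 3.5 (ii)'s bracket
p.95 l.3–7, paraphrase): if `e` is `G`-equivariant and `S ⊆ ∏_{|t|} Ψ_cns,|t|` satisfies «for every `g` and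
`y ∈ S` there is a family `u` with values in `U` such that `u · g_⟨F_l^⋇⟩(y) ∈ S`», then the pull-back of `S` along
the Kummer copies satisfies the same with families `v` such that `e ∘ v` takes values in `U`.
(IUTchII §3 Cor 3.6 (ii), kurims p.100) [claim: Mochizuki2012, status: disputed] -/
theorem exists_mul_piIso_mem_comap_of_equivariant (hequiv : ∀ (g : G) (n : N), e (γ g n) = β g (e n))
    (S : Submonoid (T → M)) (U : Set M)
    (hS : ∀ (g : G) (y : T → M), y ∈ S → ∃ u : T → M, (∀ t, u t ∈ U) ∧ u * piIso T (β g) y ∈ S)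
    (g : G) {x : T → N} (hx : x ∈ S.comap (piIso T e).toMonoidHom) :
    ∃ v : T → N, (∀ t, e (v t) ∈ U) ∧ v * piIso T (γ g) x ∈ S.comap (piIso T e).toMonoidHom := by
  change piIso T e x ∈ S at hx
  obtain ⟨u, huU, hu⟩ := hS g (piIso T e x) hx
  have hue : piIso T e (piIso T e.symm u) = u := funext fun t => e.apply_symm_apply (u t)
  refine ⟨piIso T e.symm u, fun t => ?_, ?_⟩
  · change e (e.symm (u t)) ∈ U
    rw [e.apply_symm_apply]
    exact huU t
  · change piIso T e (piIso T e.symm u * piIso T (γ g) x) ∈ S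
    rw [map_mul, piIso_equivariant γ β e hequiv, hue]
    exact hu

/-- **Transport of diagonal stability UP TO TORSION** (Cor 3.6 (ii) p.100 l.23–26 «natural action by
`G_v(M^Θ_*)_{⟨F_l^⋇⟩}`» read together with Cor 3.5 (ii)'s «up to multiplication by an element of the `N`-torsion
subgroup» p.95 l.3–7 and Rmk 3.6.1 p.101, paraphrase): the special case `U = {m | IsOfFinOrder m}`; the transported
family is again torsion since `e` is an isomorphism. (IUTchII §3 Cor 3.6 (ii), kurims p.100)
[claim: Mochizuki2012, status: disputed] -/
theorem exists_torsion_mul_piIso_mem_comap_of_equivariant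
    (hequiv : ∀ (g : G) (n : N), e (γ g n) = β g (e n)) (S : Submonoid (T → M))
    (hS : ∀ (g : G) (y : T → M), y ∈ S → ∃ u : T → M, (∀ t, IsOfFinOrder (u t)) ∧ u * piIso T (β g) y ∈ S)
    (g : G) {x : T → N} (hx : x ∈ S.comap (piIso T e).toMonoidHom) :
    ∃ v : T → N, (∀ t, IsOfFinOrder (v t)) ∧ v * piIso T (γ g) x ∈ S.comap (piIso T e).toMonoidHom := by
  obtain ⟨v, hv, h⟩ :=
    exists_mul_piIso_mem_comap_of_equivariant γ β e hequiv S {m | IsOfFinOrder m} hS g hx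
  refine ⟨v, fun t => ?_, h⟩
  have h1 : IsOfFinOrder (e.symm (e (v t))) := e.symm.toMonoidHom.isOfFinOrder (hv t)
  rwa [e.symm_apply_apply] at h1

/-- Exact diagonal stability is the case `u = 1` of stability up to torsion (so the exact junction of
`BadPrimeGaussianMonoidsCor36Proofs.lean` §1 is the special case of this file's). (IUTchII §3 Cor 3.5 (ii), kurims p.95) [claim: Mochizuki2012, status: disputed] -/
theorem exists_torsion_mul_piIso_mem_of_diagonalStable (S : Submonoid (T → M))
    (hS : ∀ (g : G) (y : T → M), y ∈ S → piIso T (β g) y ∈ S) (g : G) (y : T → M) (hy : y ∈ S) :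
    ∃ u : T → M, (∀ t, IsOfFinOrder (u t)) ∧ u * piIso T (β g) y ∈ S :=
  ⟨1, fun _ => IsOfFinOrder.one, by rw [one_mul]; exact hS g y hy⟩

/-- **From a synchronization-up-to-torsion identity to stability up to torsion of the image monoid** — the
shape delivered by the Cor 3.5 (ii) `∞`-level files (abc-iut-w5-d131 `pi_conj_eq_mul_piIso_upToTorsion` /
`pi_restriction_inftyThetaMonoid_upToTorsion_of_kummer_of_fixed`, abc-iut-w4-d004 `…_ofCohomologyModel`):
if a source monoid `X` (e.g. `∞Ψ^ι_env`) is stable under an endomorphism `c` (e.g. conjugation by `s_{t₀}(g)`) and the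
product restriction satisfies `r(c x) = r(u) · φ(r x)` with a torsion family `u`, then the image `r(X)` (e.g.
`∞Ψ_ξ`) is `φ`-stable up to torsion — no inverse of `r(u)` is needed. (IUTchII §3 Cor 3.5 (ii), kurims p.95)
[claim: Mochizuki2012, status: disputed] -/
theorem exists_torsion_mul_mem_map_of_sync {H : Type*} [Monoid H] (X : Submonoid H) (c : H → H)
    (hX : ∀ x ∈ X, c x ∈ X) (r : T → (H →* M)) (φ : (T → M) ≃* (T → M))
    (hsync : ∀ x ∈ X, ∃ u : T → H, (∀ t, IsOfFinOrder (u t)) ∧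
      MonoidHom.pi r (c x) = (fun t => r t (u t)) * φ (MonoidHom.pi r x))
    (y : T → M) (hy : y ∈ X.map (MonoidHom.pi r)) :
    ∃ w : T → M, (∀ t, IsOfFinOrder (w t)) ∧ w * φ y ∈ X.map (MonoidHom.pi r) := by
  obtain ⟨x, hx, rfl⟩ := hy
  obtain ⟨u, hu, hru⟩ := hsync x hx
  exact ⟨fun t => r t (u t), fun t => (r t).isOfFinOrder (hu t), ⟨c x, hX x hx, hru⟩⟩

/-- **[Cor-36.ii.r9, `∞`-level, FAITHFUL FORM]** (Cor 3.6 (ii), p.100 l.23–26, with Rmk 3.6.1 p.101: the Galois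
compatibility «involving the monoids `∞Ψ`»): for ANY transported `∞`-monoid `S` — abc-iut-L6-t2's `∞Ψ_ξ` or
abc-iut-w5-d031's printed-exact `∞`-monoid arising by restriction — diagonal `G`-stability UP TO TORSION of `S`
passes to its Frobenioid-theoretic copy `(piIso e)⁻¹(S)`, GIVEN the `G`-equivariance of the Kummer isomorphism
`e` (Prop 3.3 (ii); GAP-LEDGER G-w4d019-1 datum). Stated at `∞Ψ_{F_ξ}(†F_v) = inftyFrobenioidGaussianMonoid e ξ`.
(IUTchII §3 Cor 3.6 (ii), kurims p.100) [claim: Mochizuki2012, status: disputed] -/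
theorem inftyFrobenioidGaussianMonoid_diagonalStable_upToTorsion_of_equivariant
    (hequiv : ∀ (g : G) (n : N), e (γ g n) = β g (e n)) (ξ : T → M)
    (hS : ∀ (g : G) (y : T → M), y ∈ inftyGaussianMonoid ξ →
      ∃ u : T → M, (∀ t, IsOfFinOrder (u t)) ∧ u * piIso T (β g) y ∈ inftyGaussianMonoid ξ)
    (g : G) {x : T → N} (hx : x ∈ inftyFrobenioidGaussianMonoid e ξ) :
    ∃ v : T → N, (∀ t, IsOfFinOrder (v t)) ∧ v * piIso T (γ g) x ∈ inftyFrobenioidGaussianMonoid e ξ :=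
  exists_torsion_mul_piIso_mem_comap_of_equivariant γ β e hequiv (inftyGaussianMonoid ξ) hS g hx

end UpToTorsion

/-! ### [Cor-36.ii.r9, `∞`-level] END-TO-END at `∞Ψ^ι_env(M^Θ_*)`: the Cor 3.5 (ii) faithful form consumed BY NAME -/

section InftyThetaEndToEnd

variable {S : ThetaSetting.{u}} (A : AbsTopMonoids S) (Pc : IsoClass S.PiX)
  (E : TemperedThetaMonoids.ThetaEnvData.{u, v} Pc.G) (κ : A.MTM Pc →* E.H)
  {G : Type w} [Group G] {T : Type*} {M : Type*} [CommMonoid M] {N : Type*} [CommMonoid N]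

/-- **[Cor-36.ii.r9, `∞`-level, FAITHFUL FORM, end-to-end]** (Cor 3.6 (ii) p.100 l.23–26 and third display
l.26–60 with Rmk 3.6.1 p.101, paraphrase): the Frobenioid-theoretic copy `(piIso e)⁻¹(r(∞Ψ^ι_env))` of the
restriction image of `∞Ψ^ι_env(M^Θ_*) = M^×_TM · ⟨∞θ^ι_env⟩` is stable under the diagonal `G_v,⟨F_l^⋇⟩`-action UP TO a
torsion family, GIVEN: the Kummer data of Prop 3.1 (ii) (`κ` injective with `Ψ_cns = κ(M_TM)`, equivariant),
sections `s_t` agreeing modulo `Δ`, restrictions `r_t` equivariant along the `s_t` (`hr`, print's «↞»), `hfix` on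
the class `θ`, print's root condition p.27 (`hroots`), «`M^μ_TM ⊆ M^×_TM`» (`htors`), the unit-orbit hypothesis on
the roots (`hΘU`, Cor 3.5 (ii) p.95 bracket) — all exactly the binders of abc-iut-w5-d131's
`pi_restriction_inftyThetaMonoid_upToTorsion_of_kummer_of_fixed` / `inftyThetaMonoid_conjStable_of_kummer`, consumed
BY NAME — and the `G`-equivariance `hequiv` of the Kummer isomorphism `e` (Prop 3.3 (ii); G-w4d019-1 datum).
(IUTchII §3 Cor 3.6 (ii), kurims p.100) [claim: Mochizuki2012, status: disputed] -/
theorem comap_piIso_map_inftyThetaMonoid_diagonalStable_upToTorsion (hκ : Function.Injective κ)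
    (hcns : E.constantMonoid = MonoidHom.mrange κ)
    (hκeq : ∀ (x : Pc.G) (m : A.MTM Pc), κ (A.actMTM Pc x m) = E.conj x (κ m)) (s : T → (G →* Pc.G))
    (hs : ∀ t t' g, (QuotientGroup.mk (s t g) : Pc.G ⧸ A.Delta Pc) = QuotientGroup.mk (s t' g))
    (β : G →* MulAut M) (r : T → (E.H →* M)) (hr : ∀ t g x, r t (E.conj (s t g) x) = β g (r t x))
    (ι : E.Iota) (θ : E.H) (hfix : ∀ g t, E.conj (s t g) θ = θ)
    (hroots : ∀ ϑ ∈ E.inftyThetaEnv ι, ∃ N : ℕ, 0 < N ∧ ϑ ^ N ∈ splitMonoid E.units (Submonoid.powers θ))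
    (htors : ∀ u : E.H, IsOfFinOrder u → u ∈ E.units)
    (hΘU : ∀ g t, ∀ ϑ ∈ E.inftyThetaEnv ι, ∃ u ∈ E.units, E.conj (s t g) ϑ = u * ϑ)
    (γ : G →* MulAut N) (e : N ≃* M) (hequiv : ∀ (g : G) (n : N), e (γ g n) = β g (e n))
    (t₀ : T) (g : G) {x : T → N}
    (hx : x ∈ ((E.inftyThetaMonoid ι).map (MonoidHom.pi r)).comap (piIso T e).toMonoidHom) :
    ∃ v : T → N, (∀ t, IsOfFinOrder (v t)) ∧
      v * piIso T (γ g) x ∈ ((E.inftyThetaMonoid ι).map (MonoidHom.pi r)).comap (piIso T e).toMonoidHom :=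
  exists_torsion_mul_piIso_mem_comap_of_equivariant γ β e hequiv _
    (fun g' y hy => exists_torsion_mul_mem_map_of_sync (E.inftyThetaMonoid ι) (E.conj (s t₀ g'))
      (inftyThetaMonoid_conjStable_of_kummer A Pc E κ hcns hκeq s ι hΘU g' t₀) r (piIso T (β g'))
      (fun x' hx' => by
        obtain ⟨u, hu, h⟩ := pi_restriction_inftyThetaMonoid_upToTorsion_of_kummer_of_fixed A Pc E κ hκ hcns
          hκeq s hs β r hr ι θ hfix hroots htors t₀ g' x' hx'
        exact ⟨u, fun t => (hu t).2, h⟩) y hy) g hx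

end InftyThetaEndToEnd

/-! ### [Cor-36.ii.r9, `Ψ`-level] END-TO-END at the continuous-cohomology model: abc-iut-w4-d004's Cor 3.5 (ii)
Galois clause with `hr`/`hfix` DISCHARGED (p417978), transported along the Kummer copies (v2 append) -/

section CohomologyModelEndToEnd

open Literature.AnabelianGeometry.EtaleTheta CohomologySystemOfContH1

variable {S : ThetaSetting.{u}} (A : AbsTopMonoids S) (Pc : IsoClass S.PiX)
  (E : TemperedThetaMonoids.ThetaEnvData.{u, v} Pc.G) (κ : A.MTM Pc →* E.H) {T : Type*}
  {P₀ P : TopGroup.{x}} {G' : Type x} [Group G'] [TopologicalSpace G'] [IsTopologicalGroup G']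
  (φ : P →* G') (Am : Subgroup G') [Am.Normal] [IsMulCommutative Am] (N : Subgroup P) [N.Normal]
  (ι : P₀ →* P) (hι : Continuous ι) (hH : (⊤ : Subgroup P₀).map ι ≤ N)
  (j : Pc.G →* P) (ψ : Additive E.H ≃+ h1Lim φ Am N ⊥) (γ : T → P) (s : T → (P₀ →* Pc.G))
  {Nf : Type*} [CommMonoid Nf]

/-- **[Cor-36.ii.r9, `Ψ`-level, at the cohomology model]** (Cor 3.6 (ii) p.100 l.23–26 «each monoid
`Ψ_{F_ξ}(†F_v)` is equipped with a natural action by `G_v(M^Θ_*)_{⟨F_l^⋇⟩}`», paraphrase): the Frobenioid-theoretic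
copy `(piIso e)⁻¹(Ψ_ξ)` of the Gaussian monoid `Ψ_ξ = R(M^×_TM · θ^ℕ)` at the continuous-cohomology model is
EXACTLY stable under the diagonal `G_v,⟨F_l^⋇⟩`-action `h1LimConjMulAut (φ ∘ ι)`, the Cor 3.5 (ii) junction
hypotheses `hr`/`hfix` being THEOREMS there (abc-iut-w4-d004 `map_pi_diagonalStable_ofCohomologyModel`, p417978,
consumed BY NAME with exactly its binders: Kummer data of Prop 3.1 (ii), sections agreeing modulo `Δ`, model
identification `(j, ψ)`, presentation `j ∘ s_t = γ_t ι γ_t⁻¹` with `ι(Π₀) ≤ Π_Ÿ`, `θ` top-level, restrictions pinned) —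
GIVEN the `G_v`-equivariance `hequiv` of the Kummer isomorphism `e` onto the cohomology target (Prop 3.3 (ii);
G-w4d019-1 datum). (IUTchII §3 Cor 3.6 (ii), kurims p.100) [claim: Mochizuki2012, status: disputed] -/
theorem comap_piIso_map_thetaSplit_diagonalStable_ofCohomologyModel (hκ : Function.Injective κ)
    (hcns : E.constantMonoid = MonoidHom.mrange κ)
    (hκeq : ∀ (x : Pc.G) (m : A.MTM Pc), κ (A.actMTM Pc x m) = E.conj x (κ m))
    (hs : ∀ t t' g, (QuotientGroup.mk (s t g) : Pc.G ⧸ A.Delta Pc) = QuotientGroup.mk (s t' g))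
    (hψ : ∀ (p : Pc.G) (y : E.H),
      ψ (Additive.ofMul (E.conj p y)) = h1LimConj φ Am N (j p) (ψ (Additive.ofMul y)))
    (hjs : ∀ t g, j (s t g) = γ t * ι g * (γ t)⁻¹) (θ : E.H)
    (hθ : ψ (Additive.ofMul θ) ∈ Set.range ((cohomologySystemOfContH1 φ Am N).toLim ⊤))
    (R : T → (E.H →* Multiplicative (h1Lim (φ.comp ι) Am (⊤ : Subgroup P₀) ⊥)))
    (hR : ∀ t y, Multiplicative.toAdd (R t y) =
      h1LimComap φ Am ι hι hH (h1LimConj φ Am N (γ t)⁻¹ (ψ (Additive.ofMul y))))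
    (γF : P₀ →* MulAut Nf) (e : Nf ≃* Multiplicative (h1Lim (φ.comp ι) Am (⊤ : Subgroup P₀) ⊥))
    (hequiv : ∀ (g : P₀) (n : Nf), e (γF g n) = h1LimConjMulAut (φ.comp ι) Am ⊤ g (e n))
    (t₀ : T) (g : P₀) :
    (((splitMonoid E.units (Submonoid.powers θ)).map (MonoidHom.pi R)).comap (piIso T e).toMonoidHom).map
        (piIso T (γF g)).toMonoidHom =
      ((splitMonoid E.units (Submonoid.powers θ)).map (MonoidHom.pi R)).comap (piIso T e).toMonoidHom :=
  map_piIso_comap_eq_of_equivariant γF (h1LimConjMulAut (φ.comp ι) Am ⊤) e hequiv _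
    (fun g' _ hy => mem_of_map_piIso_eq
      (map_pi_diagonalStable_ofCohomologyModel A Pc E κ φ Am N ι hι hH j ψ γ s hκ hcns hκeq hs hψ hjs θ hθ R
        hR t₀ g') hy) g

end CohomologyModelEndToEnd

/-! ### [Cor-36.ii.r9] the Kummer copies as LABELED KUMMER MAPS (v3 append): transport along a family of
equivariant HOMOMORPHISMS `f_t : (Ψ_{†C_v})_t → Ψ_cns(M^Θ_*)_t` — no isomorphism onto the target is needed

SELF-AUDIT (abc-iut-w5-d192, 2026-08-26T03:40Z) of the v2 theorem
`comap_piIso_map_thetaSplit_diagonalStable_ofCohomologyModel`: it types the Kummer copy of Cor 3.6 (i) as an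
ISOMORPHISM `e : N ≃* M` onto abc-iut-w4-d004's cohomology TARGET `M = lim_{K₀} H¹(Π₀|_{K₀}, −)` of the decomposition
group — a GROUP; at the intended data `(Ψ_{†C_v})_t ≅ O^▷_{F̄_v}` is a monoid that is not a group, so that binder is
not instantiable there: the theorem is kernel-true, but AT THAT MODEL its `e` is of the idle kind (at
abc-iut-L6-t2's abstraction, where `M` is the carrier of `Ψ_cns(M^Θ_*)_{|t|}` itself, the isomorphism typing of
p414485 / p418727 is the printed one, Cor 3.6 (i) p.99 l.44–47). The faithful typing at the cohomology model is by
the labeled Kummer MAPS `f_t := R_t ∘ κ : O → lim H¹` (injective homomorphisms, `G_v`-equivariant through the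
sections `s_t`), and Cor 3.6 (ii)'s «↷» transports along ANY equivariant family of homomorphisms with
label-dependent actions `γ_t = ρ ∘ s_t` on the literal copies (print p.99 l.40–47: `G_v(M^Θ_*)_t ↷ (Ψ_{†C_v})_t`).
The theorems below do exactly that and end with the corrected cohomology-model statement
`pi_section_mem_comap_labelKummer_thetaSplit_ofCohomologyModel`, whose Frobenioid-side data `(O, ρ, κ_O, hκOeq)` =
«an equivariant Kummer map of the constant monoid» is instantiable NOW by `(A.MTM Pc, A.actMTM Pc, κ, hκeq)` (the
Prop 3.1 (ii) data already bound) and by `†F_v`'s `Ψ_{†C_v}` through J5 of SUBDAG-IUTchII-Prop-31-33-34. -/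

section LabelKummerMaps

variable {T : Type u} {M : Type v} [CommMonoid M] {N : Type w} [CommMonoid N] {G : Type*} [Group G]
  (γ : T → (G →* MulAut N)) (β : G →* MulAut M) (f : T → (N →* M))

/-- The labeled Kummer maps assembled into one homomorphism `∏_t (Ψ_{†C_v})_t → ∏_t Ψ_cns,t`,
`x ↦ (f_t x_t)_t`, evaluate componentwise. (IUTchII §3 Cor 3.6 (i), kurims p.99)
[claim: Mochizuki2012, status: disputed] -/
theorem pi_comp_eval_apply (x : T → N) (t : T) :
    (MonoidHom.pi fun t => (f t).comp (Pi.evalMonoidHom (fun _ : T => N) t)) x t = f t (x t) := rfl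

/-- **Transport of EXACT diagonal stability along an equivariant family of homomorphisms** (Cor 3.6 (ii)
p.100 l.23–26 «natural action by `G_v(M^Θ_*)_{⟨F_l^⋇⟩}`», with the copies of (i) p.99 l.40–47, paraphrase): if
`f_t (γ_t(g) n) = β(g) (f_t n)` for all labels and `S ⊆ ∏_t Ψ_cns,t` is stable under the diagonal `β`-action, then
the pull-back `(∏ f_t)⁻¹(S)` is stable under the labelwise action `x ↦ (γ_t(g) x_t)_t`.
(IUTchII §3 Cor 3.6 (ii), kurims p.100) [claim: Mochizuki2012, status: disputed] -/
theorem pi_action_mem_comap_of_equivariant_family (hf : ∀ t g n, f t (γ t g n) = β g (f t n))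
    (S : Submonoid (T → M)) (hS : ∀ (g : G) (y : T → M), y ∈ S → piIso T (β g) y ∈ S) (g : G) {x : T → N}
    (hx : x ∈ S.comap (MonoidHom.pi fun t => (f t).comp (Pi.evalMonoidHom (fun _ : T => N) t))) :
    (fun t => γ t g (x t)) ∈ S.comap (MonoidHom.pi fun t => (f t).comp (Pi.evalMonoidHom (fun _ : T => N) t)) := by
  change (fun t => f t (γ t g (x t))) ∈ S
  have hx' : (fun t => f t (x t)) ∈ S := hx
  have hfx : (fun t => f t (γ t g (x t))) = piIso T (β g) (fun t => f t (x t)) := funext fun t => hf t g (x t)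
  rw [hfx]
  exact hS g _ hx'

/-- **Transport of diagonal stability UP TO TORSION along an equivariant family of homomorphisms** (the
`∞`-level faithful form, Cor 3.5 (ii) bracket p.95 l.3–7 / Rmk 3.6.1 p.101, paraphrase), for torsion families
taken IN THE IMAGE of the Kummer maps (as the Cor 3.5 (ii) files deliver them: `(R_t u_t)_t` with `u_t ∈ M^×_TM`,
and `M^×_TM ⊆ Ψ_cns = ` image of the Kummer map). (IUTchII §3 Cor 3.6 (ii), kurims p.100)
[claim: Mochizuki2012, status: disputed] -/
theorem exists_torsion_mul_pi_action_mem_comap_of_equivariant_family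
    (hf : ∀ t g n, f t (γ t g n) = β g (f t n)) (S : Submonoid (T → M))
    (hS : ∀ (g : G) (y : T → M), y ∈ S →
      ∃ v : T → N, (∀ t, IsOfFinOrder (v t)) ∧ (fun t => f t (v t)) * piIso T (β g) y ∈ S)
    (g : G) {x : T → N}
    (hx : x ∈ S.comap (MonoidHom.pi fun t => (f t).comp (Pi.evalMonoidHom (fun _ : T => N) t))) :
    ∃ v : T → N, (∀ t, IsOfFinOrder (v t)) ∧
      v * (fun t => γ t g (x t)) ∈
        S.comap (MonoidHom.pi fun t => (f t).comp (Pi.evalMonoidHom (fun _ : T => N) t)) := by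
  have hx' : (fun t => f t (x t)) ∈ S := hx
  obtain ⟨v, hv, h⟩ := hS g _ hx'
  refine ⟨v, hv, ?_⟩
  change (fun t => f t (v t * γ t g (x t))) ∈ S
  have hfx : (fun t => f t (v t * γ t g (x t))) = (fun t => f t (v t)) * piIso T (β g) (fun t => f t (x t)) :=
    funext fun t => by rw [map_mul, hf]; rfl
  rw [hfx]
  exact h

/-- **Equivariance of the labeled Kummer maps** `f_t := R_t ∘ κ_O` for the label-`t` action `ρ ∘ s_t` (print
p.99 l.40–47: `G_v(M^Θ_*)_t ↷ (Ψ_{†C_v})_t ⥲ Ψ_cns(M^Θ_*)_t`, paraphrase), from the `Π_X`-equivariance of the Kummer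
map `κ_O` of the constant monoid (Prop 3.3 (ii) / Prop 3.1 (ii) datum `hκOeq`, G-w4d019-1) and the equivariance
of the restrictions along the sections (Cor 3.5 (ii) `hr`; a THEOREM at the cohomology model, abc-iut-w4-d004
`restriction_conj_section_eq`). (IUTchII §3 Cor 3.6 (i), kurims p.99) [claim: Mochizuki2012, status: disputed] -/
theorem labelKummer_equivariant {P' : Type*} [Group P'] (E : TemperedThetaMonoids.ThetaEnvData P')
    {O : Type*} [CommMonoid O] (ρ : P' →* MulAut O) (κO : O →* E.H)
    (hκOeq : ∀ (p : P') (o : O), κO (ρ p o) = E.conj p (κO o)) (s : T → (G →* P'))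
    (R : T → (E.H →* M)) (hr : ∀ t g y, R t (E.conj (s t g) y) = β g (R t y)) (t : T) (g : G) (o : O) :
    ((R t).comp κO) ((ρ.comp (s t)) g o) = β g (((R t).comp κO) o) := by
  change R t (κO (ρ (s t g) o)) = β g (R t (κO o))
  rw [hκOeq, hr]

end LabelKummerMaps

section CohomologyModelLabelKummer

open Literature.AnabelianGeometry.EtaleTheta CohomologySystemOfContH1

variable {S : ThetaSetting.{u}} (A : AbsTopMonoids S) (Pc : IsoClass S.PiX)
  (E : TemperedThetaMonoids.ThetaEnvData.{u, v} Pc.G) (κ : A.MTM Pc →* E.H) {T : Type*}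
  {P₀ P : TopGroup.{x}} {G' : Type x} [Group G'] [TopologicalSpace G'] [IsTopologicalGroup G']
  (φ : P →* G') (Am : Subgroup G') [Am.Normal] [IsMulCommutative Am] (N : Subgroup P) [N.Normal]
  (ι : P₀ →* P) (hι : Continuous ι) (hH : (⊤ : Subgroup P₀).map ι ≤ N)
  (j : Pc.G →* P) (ψ : Additive E.H ≃+ h1Lim φ Am N ⊥) (γ : T → P) (s : T → (P₀ →* Pc.G))

/-- **[Cor-36.ii.r9, `Ψ`-level, at the cohomology model, FAITHFUL TYPING]** (Cor 3.6 (ii) p.100 l.23–26 with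
the copies of (i) p.99 l.40–47, paraphrase): with the labeled Kummer MAPS `f_t := R_t ∘ κ_O : O → lim H¹(Π₀|…)` of an
equivariant Kummer datum `(O, ρ, κ_O)` of the constant monoid (instantiable by abc-iut-w4-d019's Prop 3.1 (ii) data
`(M_TM(Π), actMTM, κ)` and, through J5, by `Ψ_{†C_v}`), the Frobenioid-theoretic copy
`(∏ f_t)⁻¹(Ψ_ξ)` of the Gaussian monoid `Ψ_ξ = R(M^×_TM · θ^ℕ)` is stable under the labelwise action
`x ↦ (ρ(s_t g) x_t)_t` of `g ∈ G_v`, the Cor 3.5 (ii) hypotheses `hr`/`hfix` being THEOREMS there (abc-iut-w4-d004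
`map_pi_diagonalStable_ofCohomologyModel`, `restriction_conj_section_eq`, p417978, consumed BY NAME with exactly their
binders). No isomorphism onto the cohomology target is assumed (corrects the typing of v2's
`comap_piIso_map_thetaSplit_diagonalStable_ofCohomologyModel`). (IUTchII §3 Cor 3.6 (ii), kurims p.100)
[claim: Mochizuki2012, status: disputed] -/
theorem pi_section_mem_comap_labelKummer_thetaSplit_ofCohomologyModel (hκ : Function.Injective κ)
    (hcns : E.constantMonoid = MonoidHom.mrange κ)
    (hκeq : ∀ (x : Pc.G) (m : A.MTM Pc), κ (A.actMTM Pc x m) = E.conj x (κ m))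
    (hs : ∀ t t' g, (QuotientGroup.mk (s t g) : Pc.G ⧸ A.Delta Pc) = QuotientGroup.mk (s t' g))
    (hψ : ∀ (p : Pc.G) (y : E.H),
      ψ (Additive.ofMul (E.conj p y)) = h1LimConj φ Am N (j p) (ψ (Additive.ofMul y)))
    (hjs : ∀ t g, j (s t g) = γ t * ι g * (γ t)⁻¹) (θ : E.H)
    (hθ : ψ (Additive.ofMul θ) ∈ Set.range ((cohomologySystemOfContH1 φ Am N).toLim ⊤))
    (R : T → (E.H →* Multiplicative (h1Lim (φ.comp ι) Am (⊤ : Subgroup P₀) ⊥)))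
    (hR : ∀ t y, Multiplicative.toAdd (R t y) =
      h1LimComap φ Am ι hι hH (h1LimConj φ Am N (γ t)⁻¹ (ψ (Additive.ofMul y))))
    {O : Type*} [CommMonoid O] (ρ : Pc.G →* MulAut O) (κO : O →* E.H)
    (hκOeq : ∀ (p : Pc.G) (o : O), κO (ρ p o) = E.conj p (κO o)) (t₀ : T) (g : P₀) {x : T → O}
    (hx : x ∈ ((splitMonoid E.units (Submonoid.powers θ)).map (MonoidHom.pi R)).comap
      (MonoidHom.pi fun t => ((R t).comp κO).comp (Pi.evalMonoidHom (fun _ : T => O) t))) :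
    (fun t => ρ (s t g) (x t)) ∈ ((splitMonoid E.units (Submonoid.powers θ)).map (MonoidHom.pi R)).comap
      (MonoidHom.pi fun t => ((R t).comp κO).comp (Pi.evalMonoidHom (fun _ : T => O) t)) :=
  pi_action_mem_comap_of_equivariant_family (fun t => ρ.comp (s t)) (h1LimConjMulAut (φ.comp ι) Am ⊤)
    (fun t => (R t).comp κO)
    (labelKummer_equivariant (h1LimConjMulAut (φ.comp ι) Am ⊤) E ρ κO hκOeq s R
      (fun t g' y => restriction_conj_section_eq E φ Am N ι hι j ψ γ s hH hψ hjs R hR t g' y))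
    _ (fun g' _ hy => mem_of_map_piIso_eq
      (map_pi_diagonalStable_ofCohomologyModel A Pc E κ φ Am N ι hι hH j ψ γ s hκ hcns hκeq hs hψ hjs θ hθ R
        hR t₀ g') hy) g hx

/-- **[Cor-36.ii.r9, `∞`-level, cohomology model, FAITHFUL TYPING]** (Cor 3.6 (ii) p.100 «∞»-row with Cor 3.5 (ii)
p.95 l.3–7, Rmk 3.6.1 p.101, paraphrase): for an INJECTIVE equivariant Kummer datum `(O, ρ, κ_O)` with image
`Ψ_cns` (e.g. `(M_TM, actMTM, κ)` itself), `(∏ R_t∘κ_O)⁻¹(R(∞Ψ^{ι₀}_env))` is stable under `x ↦ (ρ(s_t g) x_t)_t` UP TO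
a torsion family — abc-iut-w4-d004 `pi_restriction_inftyThetaMonoid_upToTorsion_ofCohomologyModel` (p417978) and
abc-iut-w5-d131 `inftyThetaMonoid_conjStable_of_kummer` (p416348, `hΘU`) BY NAME; the torsion units pull back through
`κ_O` since `M^×_TM ⊆ Ψ_cns = κ_O(O)`. (IUTchII §3 Cor 3.6 (ii), kurims p.100) [claim: Mochizuki2012, status: disputed] -/
theorem exists_torsion_mul_pi_section_mem_comap_labelKummer_inftyThetaMonoid_ofCohomologyModel
    (hκ : Function.Injective κ) (hcns : E.constantMonoid = MonoidHom.mrange κ)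
    (hκeq : ∀ (x : Pc.G) (m : A.MTM Pc), κ (A.actMTM Pc x m) = E.conj x (κ m))
    {K : Type*} [Group K] (a : P →* K) (hΔ : ∀ x : Pc.G, a (j x) = 1 → x ∈ A.Delta Pc) (hγ : ∀ t, a (γ t) = 1)
    (hψ : ∀ (p : Pc.G) (y : E.H), ψ (Additive.ofMul (E.conj p y)) = h1LimConj φ Am N (j p) (ψ (Additive.ofMul y)))
    (hjs : ∀ t g, j (s t g) = γ t * ι g * (γ t)⁻¹) (i₀ : E.Iota) (θ : E.H)
    (hθ : ψ (Additive.ofMul θ) ∈ Set.range ((cohomologySystemOfContH1 φ Am N).toLim ⊤))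
    (hroots : ∀ ϑ ∈ E.inftyThetaEnv i₀, ∃ n : ℕ, 0 < n ∧ ϑ ^ n ∈ splitMonoid E.units (Submonoid.powers θ))
    (htors : ∀ u : E.H, IsOfFinOrder u → u ∈ E.units)
    (hΘU : ∀ (g : P₀) (t : T), ∀ ϑ ∈ E.inftyThetaEnv i₀, ∃ u ∈ E.units, E.conj (s t g) ϑ = u * ϑ)
    (R : T → (E.H →* Multiplicative (h1Lim (φ.comp ι) Am (⊤ : Subgroup P₀) ⊥)))
    (hR : ∀ t y, Multiplicative.toAdd (R t y) = h1LimComap φ Am ι hι hH (h1LimConj φ Am N (γ t)⁻¹ (ψ (Additive.ofMul y))))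
    {O : Type*} [CommMonoid O] (ρ : Pc.G →* MulAut O) (κO : O →* E.H) (hκO : Function.Injective κO)
    (hcnsO : E.constantMonoid = MonoidHom.mrange κO) (hκOeq : ∀ (p : Pc.G) (o : O), κO (ρ p o) = E.conj p (κO o))
    (t₀ : T) (g : P₀) {x : T → O} (hx : x ∈ ((E.inftyThetaMonoid i₀).map (MonoidHom.pi R)).comap
      (MonoidHom.pi fun t => ((R t).comp κO).comp (Pi.evalMonoidHom (fun _ : T => O) t))) :
    ∃ v : T → O, (∀ t, IsOfFinOrder (v t)) ∧ v * (fun t => ρ (s t g) (x t)) ∈ ((E.inftyThetaMonoid i₀).map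
      (MonoidHom.pi R)).comap (MonoidHom.pi fun t => ((R t).comp κO).comp (Pi.evalMonoidHom (fun _ : T => O) t)) := by
  refine exists_torsion_mul_pi_action_mem_comap_of_equivariant_family (fun t => ρ.comp (s t))
    (h1LimConjMulAut (φ.comp ι) Am ⊤) (fun t => (R t).comp κO) (labelKummer_equivariant (h1LimConjMulAut (φ.comp ι) Am ⊤)
      E ρ κO hκOeq s R (fun t g' y => restriction_conj_section_eq E φ Am N ι hι j ψ γ s hH hψ hjs R hR t g' y))
    _ (fun g' y hy => ?_) g hx
  obtain ⟨z, hz, rfl⟩ := hy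
  obtain ⟨u, hu, hsync⟩ := pi_restriction_inftyThetaMonoid_upToTorsion_ofCohomologyModel A Pc E κ φ Am N ι hι
    hH j ψ γ s hκ hcns hκeq a hΔ hγ hψ hjs i₀ θ hθ hroots htors R hR t₀ g' z hz
  have hv : ∀ t, ∃ o : O, κO o = u t := fun t =>
    MonoidHom.mem_mrange.mp (hcnsO ▸ units_le_constantMonoid E (hu t).1 : u t ∈ MonoidHom.mrange κO)
  choose v hv using hv
  refine ⟨v, fun t => ?_, ?_⟩
  · obtain ⟨n, hn, hun⟩ := isOfFinOrder_iff_pow_eq_one.mp (hu t).2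
    exact isOfFinOrder_iff_pow_eq_one.mpr ⟨n, hn, hκO (by rw [map_pow, hv, hun, map_one])⟩
  · have hfv : (fun t => ((R t).comp κO) (v t)) = fun t => R t (u t) :=
      funext fun t => by change R t (κO (v t)) = R t (u t); rw [hv]
    rw [hfv, ← hsync]
    exact ⟨E.conj (s t₀ g') z, inftyThetaMonoid_conjStable_of_kummer A Pc E κ hcns hκeq s i₀ hΘU g' t₀ z hz, rfl⟩

end CohomologyModelLabelKummer

end BadPrimeGaussianMonoids

end Literature.IUT.HodgeArakelov
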